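import Summits.BirchSwinnertonDyer.Rank1Residual.ManinAdditive.ResidualClassSelmerKummerLaws
import Literature.NumberTheory.EllipticCurves.BSDHeegnerPointsTorsionProofs
import Literature.NumberTheory.EllipticCurves.HeegnerPoints
import Literature.NumberTheory.QuadraticFields.BinaryQuadraticFormsClassNumber
import HarnessLib
import HarnessLib.Audit.Tags

/-!
# es g37 (cell bsd-f2-manin, MEMO-es §58.9) — THEOREM M♭: the ODD-RANK twin at `N = 4p`

Setting: `N = 4p`, `p ≡ 3 (mod 4)` prime, `E(ℚ)[2] = 0`, `w_N f = +f` (odd analytic rank).  Then `φ(0) = O`, `φ` factors through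
`C = X₀(4p)/w_N`, the residual involution `ι` (induced by `w_p ≡ w_4`) has `φ̄ ∘ ι = −φ̄ + R`, `R = φ(1/4)`; the cusp `1/2` is `w_4`-fixed
and `w_N(1/2) = 1/(2p)`, so `R = 2·φ(1/2)` has the RATIONAL half `φ(1/2)` (a torsion point of odd order), `ψ̄ = φ̄ − φ(1/2)` is `ι`-odd
and defined over `ℚ`, and `t(y) := φ̄(y) − φ(1/2) ∈ E[2]` is Galois-equivariant on `Fix(ι) = {π(1/2)} ⊔ π(Fix w_p)`.
INVENTORY LEMMA (paper, MEMO-es §58.9; Riemann–Hurwitz checks at `N = 44, 76, 92`: 6, 6, 18): the fixed points of `w_p` on `Y₀(4p)` are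
the CM points with an endomorphism `±√−p` preserving the level-4 structure: `2h(−4p)` Heegner points of discriminant `−4p` (order `ℤ[√−p]`,
two `√−p`-stable cyclic `C₄ = (√−p ∓ 1)`), and for `p ≡ 7 (mod 8)` in addition `2h(−p)` Heegner points of discriminant `−p` (`C₄ = 𝔮², 𝔮̄²`)
and `2h(−p)` mixed points (`E` with CM by `O_K`, `C₄` stable under `ℤ[√−p]` only, exchanged with the `−4p` points by `w_4`); total `6h(−p)`.
Modulo `w_N` and Galois: `p ≡ 3 (8)`: ONE orbit of size `3h(−p)`; `p ≡ 7 (8)`: orbit A (discriminant `−p`) of size `h(−p)` and orbit B of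
size `2h(−p)`.  The Parity Lemma (`deg ψ̄ ≡ #{y ∈ Fix ι : ψ̄(y) = T} (mod 2)`) and `Gal` transitive on `E[2] ∖ 0` give
   THEOREM M♭:  `v₂(deg φ) = 1 ⟺ φ(τ_Q) ≠ φ(1/2)` for one (equivalently every) Heegner form `Q` of level `4p` and discriminant
   `−4p` (`p ≡ 3 (8)`) resp. `−p` (`p ≡ 7 (8)`)  — optimal `φ`; `⟹` for every datum.
In particular then `ℚ(E[2]) ⊂` the ring class field of conductor 2 (resp. the Hilbert class field) of `ℚ(√−p)`, `ℚ(√Δ) = ℚ(√−p)`, and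
`3 ∣ h(−p)` when `p ≡ 7 (8)`.  NO census value of `φ(τ_Q)` exists in the tables: the rows below are THEOREM-candidates on paper whose numeric
falsifier is the cell ask D-es-g37-2 (30-digit evaluation of `c·(I_f(τ_Q) − I_f(1/2)) mod Λ_E` on the 393 + 248 + 195 rank-1 curves of census14).
PARTITION 0 · BSD is not proved; Manin `c = 1` is not proved (these are degree laws in C2's habitat).

TYPER NOTE (typer g21, T-es-71 second file).  SOURCE = HOME/es/g37/Sketch-es-g37b.lean sha16 ae8224b10856ff00 (163 l.; es: farm
rc 0·0·0·0; BC7 3/3 + 3/3 CLEAN; MEMO-es §58.9–§58.10, pack HOME/es/g37/) VERBATIM but for two typer deltas: (i) this note; (ii) cite-key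
repairs (the sketch's tags named no references.bib key): rows 182a/182b `Gross 1984 §I.1` → key `GrossDurham1984` (B. H. Gross,
«Heegner points on X₀(N)», Modular Forms (Durham, 1983), 1984); row 182c `MEMO-es §58.2, §58.9` → key `CastanoBernard2005` (shape only,
the odd-rank prime-level parity statements; arXiv:math/0512628); rows 183a/183b → key `Cox2013` (D. A. Cox, *Primes of the form x² + ny²*,
2nd ed., Thm. 9.18 — the ring / Hilbert class field statement the proof uses); row 183c → key `Kraus1990` (A. Kraus, Manuscripta Math. 69
(1990), the classification at `p = 2` es names as the source for a proof); every tag keeps «the law is the cell's, NOT in print» and the memo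
locator.  Imports (all landed): `…ManinAdditive.ResidualClassSelmerKummerLaws`, Literature `BSDHeegnerPointsTorsionProofs`, `HeegnerPoints`,
`QuadraticFields.BinaryQuadraticFormsClassNumber`, HarnessLib(+Audit.Tags); independent of the first file `FrickeValueDegreeLaws.lean`
(same namespace `…ManinAdditive.AtkinLehnerDegree`, decl names fresh).  ROWS (es's `@[conjecture]` tags; nothing asserted): **E-es-182a
`OddRankDegreeTwoModFourForcesHeegnerValueOffCusp`**, **E-es-182b `OddRankHeegnerValueOffCuspForcesDegreeTwoModFour`**, **E-es-182c
`OddRankHeegnerValueOffCuspForcesField`**, **E-es-183a `HabitatSevenModEightForcesThreeDvdClassNumber`**, **E-es-183b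
`HabitatTwoAdicRootForcesThreeDvdClassNumber`**, **E-es-183c `HabitatKodairaFourHasTwoAdicRoot`**; defs `cuspValue`, `oddRankDecidingDisc`;
PROVED edges `three_dvd_classNumber_of_oddRank_degreeTwoModFour`, `three_dvd_classNumber_of_kodairaFour`; three `decide` membership
examples (Heegner forms at 44, 76, 92).  REFUTER: ref1/ref2 R-es-86 PENDING at landing.  No instances, no notation, no sorry.
bears_on: stmt-BirchSwinnertonDyer-22967 (C2 `ManinOddAtFour`).  BSD is not proved by this; Manin c = 1 not proved; C2 OPEN.
-/

namespace Summit.BirchSwinnertonDyer.Rank1Residual.ManinAdditive.AtkinLehnerDegree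

open scoped MatrixGroups ModularForm UpperHalfPlane
open CongruenceSubgroup WeierstrassCurve
open Literature.NumberTheory.EllipticCurves Literature.NumberTheory.EllipticCurves.ModularForms
open Summit.BirchSwinnertonDyer.Rank1Residual.ManinAdditive.ConwayCut
open Literature.NumberTheory.QuadraticFields.Quadratic

/-- The value of the modular parametrisation at a rational cusp `r`: `φ(r) = uniformize (c·{∞, r}_f)` (a torsion point by
Manin–Drinfeld; `D.atkinLehnerCuspPoint Q` is the case `r = w_Q ∞`). -/
noncomputable def cuspValue {W : WeierstrassCurve ℚ} {N : ℕ} [NeZero N] (D : ModularParametrizationData W N) (r : ℚ) :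
    (W.baseChange ℂ).toAffine.Point :=
  D.uniformize ((D.c : ℂ) * modularSymbol D.f r)

/-- The discriminant of the DECIDING orbit of `w_p`-fixed Heegner points on `X₀(4p)` (INVENTORY LEMMA): `−4p` (order `ℤ[√−p]`) when
`p ≡ 3 (mod 8)`, `−p` (maximal order, orbit A) when `p ≡ 7 (mod 8)`. -/
def oddRankDecidingDisc (p : ℕ) : ℤ := if p % 8 = 3 then -(4 * (p : ℤ)) else -(p : ℤ)

/-- **Row E-es-182a `OddRankDegreeTwoModFourForcesHeegnerValueOffCusp`** (THEOREM M♭ ⟹, MEMO-es §58.9; ANY datum: `D.φ = β ∘ φ_opt`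
with `deg β` odd·square and odd isogenies injective on `E[2]`).  `N = 4p`, `p ≡ 3 (4)`, `E(ℚ)[2] = 0`, `w_N f = f` (odd analytic rank),
`v₂(deg φ) = 1` ⟹ for EVERY Heegner form `Q` of level `N` and deciding discriminant, `φ(τ_Q) ≠ φ(1/2)` (the difference is then a
non-zero 2-torsion point).  Why it might fail: the inventory lemma's orbit count at the 4-level (verified at three levels only) or a slip in
`R = 2φ(1/2)`; numerically untested (D-es-g37-2).  [cite: GrossDurham1984, §I.1 (Heegner forms; shape only — the law is the cell's, MEMO-es §58.9, NOT in print)] -/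
@[conjecture] def OddRankDegreeTwoModFourForcesHeegnerValueOffCusp : Prop :=
  ∀ (W : WeierstrassCurve ℚ) [W.IsElliptic] {N : ℕ} [NeZero N] (D : ModularParametrizationData W N) (p : ℕ),
    p.Prime → p % 4 = 3 → N = 4 * p → W.conductorNorm ℤ = N → ¬ HasRationalTwoTorsion W →
    frickeInvolution N 2 D.f = D.f → padicValNat 2 D.modularDegree = 1 →
    ∀ Q ∈ heegnerForms N (oddRankDecidingDisc p), D.φ (heegnerTau Q) ≠ cuspValue D (1 / 2)

/-- **Row E-es-182b `OddRankHeegnerValueOffCuspForcesDegreeTwoModFour`** (THEOREM M♭ ⟸, MEMO-es §58.9; LATTICE-OPTIMAL datum, else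
`[2] ∘ φ` kills the 2-torsion difference).  Same class; if SOME Heegner form of deciding discriminant has `φ(τ_Q) ≠ φ(1/2)` then
`4 ∤ deg φ` (and `2 ∣ deg φ` always in the class, as `φ` factors through `X₀(4p)/w_N`).  Why it might fail: as 182a, plus the parity of
`h(−p)` bookkeeping for orbit A at `p ≡ 7 (8)`.  [cite: GrossDurham1984, §I.1 (shape only — the law is the cell's, MEMO-es §58.9, NOT in print)] -/
@[conjecture] def OddRankHeegnerValueOffCuspForcesDegreeTwoModFour : Prop :=
  ∀ (W : WeierstrassCurve ℚ) [W.IsElliptic] {N : ℕ} [NeZero N] (D : ModularParametrizationData W N) (p : ℕ),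
    p.Prime → p % 4 = 3 → N = 4 * p → W.conductorNorm ℤ = N →
    (∀ z ∈ D.L.lattice, ∃ w ∈ periodLattice D.f, z = D.c * w) → ¬ HasRationalTwoTorsion W →
    frickeInvolution N 2 D.f = D.f →
    (∃ Q ∈ heegnerForms N (oddRankDecidingDisc p), D.φ (heegnerTau Q) ≠ cuspValue D (1 / 2)) →
    ¬ 2 ^ 2 ∣ D.modularDegree

/-- **Row E-es-182c `OddRankHeegnerValueOffCuspForcesField`** (S-type corollary, same proof as THEOREM S / row 179a with the ring class
field of conductor 2 resp. 1 of `ℚ(√−p)`): in the class, `φ(τ_Q) ≠ φ(1/2)` for a deciding Heegner form puts a 2-torsion point over that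
ring class field, whence `ℚ(√Δ) = ℚ(√−p)` and, for `p ≡ 7 (8)`, `3 ∣ h(−p)`.  Why it might fail: only with 182a/b's identification
`2(φ(τ_Q) − φ(1/2)) = 0` (needs `λ_p = −1`, i.e. the local sign `λ₄ = −1` at `4 ∥ N`).  [cite: CastanoBernard2005, §2 (shape only: odd-rank parity statements at prime level; this law is the cell's, MEMO-es §58.2/§58.9, NOT in print)] -/
@[conjecture] def OddRankHeegnerValueOffCuspForcesField : Prop :=
  ∀ (W : WeierstrassCurve ℚ) [W.IsElliptic] {N : ℕ} [NeZero N] (D : ModularParametrizationData W N) (p : ℕ),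
    p.Prime → p % 4 = 3 → N = 4 * p → W.conductorNorm ℤ = N → ¬ HasRationalTwoTorsion W →
    frickeInvolution N 2 D.f = D.f →
    (∃ Q ∈ heegnerForms N (oddRankDecidingDisc p), D.φ (heegnerTau Q) ≠ cuspValue D (1 / 2)) →
    IsSquare (-(p : ℚ) * W.Δ) ∧ (p % 8 = 7 → 3 ∣ BinQF.classNumber (-(p : ℤ)))

/-- Edge (PROVED): 182a ∧ 182c ⟹ in the odd-rank class at `N = 4p`, `p ≡ 7 (8)`: `v₂(deg φ) = 1 → 3 ∣ h(−p)` — the odd-rank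
counterpart of THEOREM S (3), provided a deciding Heegner form exists (it does: `B ≡ p·B′`, `B′² ≡ −p⁻¹ (mod 16)` is solvable iff
`p ≡ 7 (8)`; here taken as a hypothesis). -/
theorem three_dvd_classNumber_of_oddRank_degreeTwoModFour
    (h₁ : OddRankDegreeTwoModFourForcesHeegnerValueOffCusp) (h₂ : OddRankHeegnerValueOffCuspForcesField)
    (W : WeierstrassCurve ℚ) [W.IsElliptic] {N : ℕ} [NeZero N] (D : ModularParametrizationData W N) (p : ℕ)
    (hp : p.Prime) (h8 : p % 8 = 7) (hN : N = 4 * p) (hc : W.conductorNorm ℤ = N) (hT : ¬ HasRationalTwoTorsion W)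
    (hF : frickeInvolution N 2 D.f = D.f) (hv : padicValNat 2 D.modularDegree = 1)
    (hQ : ∃ Q, Q ∈ heegnerForms N (oddRankDecidingDisc p)) :
    3 ∣ BinQF.classNumber (-(p : ℤ)) := by
  have h4 : p % 4 = 3 := by omega
  obtain ⟨Q, hQm⟩ := hQ
  have hne := h₁ W D p hp h4 hN hc hT hF hv Q hQm
  exact (h₂ W D p hp h4 hN hc hT hF ⟨Q, hQm, hne⟩).2 h8

/- Sanity (kernel): the explicit `w_p`-fixed point `τ_p♭ = (1 + i/√p)/(p+1)` of MEMO-es §58.8 is the Heegner point of the form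
`(p(p+1), −2p, 1)` of level `4p` and discriminant `−4p`; membership for `p = 11, 19` by `decide`. -/
example : ((11 * 12 : ℤ), (-(2 * 11) : ℤ), (1 : ℤ)) ∈ heegnerForms 44 (oddRankDecidingDisc 11) := by
  refine ⟨by decide, by decide, by decide, ?_⟩
  intro d _ _ hd
  exact isUnit_of_dvd_one hd
example : ((19 * 20 : ℤ), (-(2 * 19) : ℤ), (1 : ℤ)) ∈ heegnerForms 76 (oddRankDecidingDisc 19) := by
  refine ⟨by decide, by decide, by decide, ?_⟩
  intro d _ _ hd
  exact isUnit_of_dvd_one hd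
/- and a deciding form of discriminant `−23` at level `92` (`p = 23 ≡ 7 (8)`): `(92, 69, 13)`, `69² − 4·92·13 = 4761 − 4784 = −23`. -/
example : ((92 : ℤ), (69 : ℤ), (13 : ℤ)) ∈ heegnerForms 92 (oddRankDecidingDisc 23) := by
  refine ⟨by decide, by decide, by decide, ?_⟩
  intro d _ h₂ h₃
  have h4 : d ∣ 4 := by
    have := dvd_sub h₂ (dvd_mul_of_dvd_right h₃ 5)
    norm_num at this
    exact this
  have h1 : d ∣ 1 := by
    have := dvd_sub h₃ (dvd_mul_of_dvd_right h4 3)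
    norm_num at this
    exact this
  exact isUnit_of_dvd_one h1

/-! ### THEOREM S♭ (MEMO-es §58.10): the habitat forces `3 ∣ h(−p)` whenever the 2-division field is unramified at 2

Paper proof (complete): conductor `4p`, `p ≡ 3 (4)`, `E(ℚ)[2] = 0`, `ℚ(√Δ) = ℚ(√−p) =: K` ⟹ `F = ℚ(E[2])` is an `S₃`-field with resolvent `K`,
unramified outside `{2, p, ∞}` (good reduction elsewhere), with `e_p(F) = 2` absorbed by `K` (Tate curve: `ℚ_p(E[2]) = ℚ_p(√q)`, and
`ℚ_p(√q, √−p) ⊂ ℚ_p(√−p)·ℚ_p^{nr}`), so `FK/K` is unramified away from `2`; at `2`: if `p ≡ 7 (8)` then `Δ ∈ ℚ₂^{×2}`, so `Gal(ℚ₂(E[2])/ℚ₂) ≤ A₃`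
and a Galois cubic extension of `ℚ₂` is unramified (`μ₃ ⊄ ℚ₂`): AUTOMATIC; if `p ≡ 3 (8)` the hypothesis «the 2-division cubic has a root in
`ℚ₂`» gives `ℚ₂(E[2]) ⊂ ℚ₄`.  Hence `FK ⊂ H₁(K)`, the Hilbert class field, and `3 ∣ [H₁ : K] = h(−p)`.
CENSUS (census26.py / census25, Cremona `4p < 5·10⁵`, `T` odd, habitat): `p ≡ 7 (8)`: 413 curves, all `3 ∣ h(−p)` (0 violations; and all
have the 2-division cubic irreducible over `ℚ₂`, all `v₂(Δ_min) = 4`); `p ≡ 3 (8)`: cubic has a `ℚ₂`-root for exactly the 404 curves with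
`v₂(Δ_min) = 4` (Kodaira IV), all with `3 ∣ h(−p)`; no root (`e = 3`) for the 492 with `v₂(Δ_min) = 8` (IV*), of which 316 have `3 ∤ h(−p)`. -/

/-- **Row E-es-183a `HabitatSevenModEightForcesThreeDvdClassNumber`** (THEOREM S♭, `p ≡ 7 (8)`: complete paper proof above; no
parametrisation, no rank, any model).  Census: 413 / 0.  Why it might fail: only via the local step at `p` (the twist in the non-split
case acts trivially on `E[2]`).  [cite: Cox2013, Thm. 9.18 (ring / Hilbert class fields; the law is the cell's, MEMO-es §58.10, NOT in print)] -/
@[conjecture] def HabitatSevenModEightForcesThreeDvdClassNumber : Prop :=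
  ∀ (W : WeierstrassCurve ℚ) [W.IsElliptic] (p : ℕ), p.Prime → p % 8 = 7 → W.conductorNorm ℤ = 4 * p →
    ¬ HasRationalTwoTorsion W → IsSquare (-(p : ℚ) * W.Δ) → 3 ∣ BinQF.classNumber (-(p : ℤ))

/-- **Row E-es-183b `HabitatTwoAdicRootForcesThreeDvdClassNumber`** (THEOREM S♭, `p ≡ 3 (8)`, hypothesis: the 2-division cubic
`4X³ + b₂X² + 2b₄X + b₆` (Mathlib `twoTorsionPolynomial`) has a root in `ℚ₂` — empirically ⟺ Kodaira IV at 2 in the habitat).  Census: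
404 / 0.  Why it might fail: as 183a.  [cite: Cox2013, Thm. 9.18 (shape only; the law is the cell's, MEMO-es §58.10, NOT in print)] -/
@[conjecture] def HabitatTwoAdicRootForcesThreeDvdClassNumber : Prop :=
  ∀ (W : WeierstrassCurve ℚ) [W.IsElliptic] (p : ℕ), p.Prime → p % 8 = 3 → W.conductorNorm ℤ = 4 * p →
    ¬ HasRationalTwoTorsion W → IsSquare (-(p : ℚ) * W.Δ) →
    (∃ x : ℚ_[2], (W.map (Rat.castHom ℚ_[2])).twoTorsionPolynomial.toPoly.eval x = 0) →
    3 ∣ BinQF.classNumber (-(p : ℤ))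

/-- **Row E-es-183c `HabitatKodairaFourHasTwoAdicRoot`** (the LOCAL LEMMA left open: in the habitat at `p ≡ 3 (8)`, `v₂(Δ_min) = 4`
⟹ the 2-division cubic has a root in `ℚ₂`; census26: 404 / 0, and `v₂(Δ_min) = 8` ⟹ no root: 492 / 0).  Why it might fail: a Kodaira-IV
curve at 2 outside Kraus's generic case; source for a proof: Kraus 1990 (classification at 2).
[cite: Kraus1990, the classification of additive reduction at p = 2 (named by es as the source for a proof; the row as typed is the cell's, MEMO-es §58.10, NOT in print)] -/
@[conjecture] def HabitatKodairaFourHasTwoAdicRoot : Prop :=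
  ∀ (W : WeierstrassCurve ℚ) [W.IsElliptic] [W.IsGloballyMinimal] (p : ℕ), p.Prime → p % 8 = 3 → W.conductorNorm ℤ = 4 * p →
    ¬ HasRationalTwoTorsion W → IsSquare (-(p : ℚ) * W.Δ) → padicValRat 2 W.Δ = 4 →
    ∃ x : ℚ_[2], (W.map (Rat.castHom ℚ_[2])).twoTorsionPolynomial.toPoly.eval x = 0

/-- Edge (PROVED): 183b ∧ 183c ⟹ «habitat, `p ≡ 3 (8)`, Kodaira IV (minimal `v₂(Δ) = 4`) ⟹ `3 ∣ h(−p)`» (census26: 404 / 0). -/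
theorem three_dvd_classNumber_of_kodairaFour
    (h₁ : HabitatTwoAdicRootForcesThreeDvdClassNumber) (h₂ : HabitatKodairaFourHasTwoAdicRoot)
    (W : WeierstrassCurve ℚ) [W.IsElliptic] [W.IsGloballyMinimal] (p : ℕ) (hp : p.Prime) (h8 : p % 8 = 3)
    (hc : W.conductorNorm ℤ = 4 * p) (hT : ¬ HasRationalTwoTorsion W) (hsq : IsSquare (-(p : ℚ) * W.Δ))
    (hv : padicValRat 2 W.Δ = 4) : 3 ∣ BinQF.classNumber (-(p : ℤ)) :=
  h₁ W p hp h8 hc hT hsq (h₂ W p hp h8 hc hT hsq hv)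

end Summit.BirchSwinnertonDyer.Rank1Residual.ManinAdditive.AtkinLehnerDegree
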